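import Summits.PneNP.PneNP.Theses.OneSlice
import Summits.PneNP.PneNP.Theorems.OneSliceShallowSliceBoundForcing
import Summits.PneNP.PneNP.Theorems.OneSliceShallowSliceBoundNotSharp
import Summits.PneNP.PneNP.Theorems.OneSliceShallowSliceBoundBinarise

/-!
# Route OneSlice: proof of the support item `ShallowSliceBound` (stmt-PneNP-14083)

`shallowSliceBound_proof : Summit.PneNP.PneNP.Theses.OneSlice.ShallowSliceBound` — for every depth `d` and
exponent `c` there are `k ≥ 3` and `δ > 0` such that, eventually in `n`, for every central `j` every
`{∧ₘ, ∨ₘ}`-circuit of `acDepth ≤ d` that errs against `k`-CLIQUE on at most `δ · #slice_j` graphs of the slice `j`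
has more than `n^c` gates. Composition (pattern of the kernel-checked skeleton `ShallowSliceConc_of` of
`Cruxes/ConstantBand/Lines/sharpness-sandwich.lean`, whose two hard stubs are replaced by the seat's own legs):
`k = 8c + 25` (binarised size `≤ n^{2c+5} < n^{k/4}`), `η = 1/4`; `(θ₀, δ_F)` from **Leg A** `forcing_up`
(`…Forcing.lean`, Rossman's Theorem 1 on a random critical restriction), `θ = min θ₀ ½`; `j₀` from **Leg B**
`shallow_not_sharp` (`…NotSharp.lean`, random sub-cubes + Tal's Fourier tails) at `(d, 2c, θ/2, ε = 1/8)`;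
`δ = min δ_F ⅛`. For large `n`, central `j` and a shallow `D` of size `≤ n^c` accurate on slice `j`: binarise
(`stub_binarise`, `…Binarise.lean`), force `a_t ≥ 3/4` at `t = ⌈j + j^{1-θ}⌉`, bound `a_j ≤ 1/3 + 1/8` (clique
scarcity `ts_eventually_window` + accuracy) and `a_t ≤ a_j + 1/8` (Leg B): contradiction.
-/

set_option linter.dupNamespace false

noncomputable section

namespace Summit.PneNP.PneNP.Theorems

open Finset Filter Literature.Computability.Complexity Classical
open Summit.PneNP.PneNP.Theorems.ConstantBand.Negative (Edge thr Central slice errSet)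
open Summit.PneNP.PneNP.Cruxes.ConstantBand.FlatPriorRelativeMinterms
  (ts_mem_slice ts_card_slice_pos ts_mem_errSet ts_sliceFrac_clique_le ts_eventually_window)
open Summit.PneNP.PneNP.Cruxes.SliceACZero.RussoWindowLadder (wt sliceAvg)
open Summit.PneNP.PneNP.Theorems.ShallowSliceBound
open scoped Topology

namespace ShallowSliceBound

/-- Size of the binarised circuit: `(s+1)(s + C(n,2) + 1) ≤ n^{2c+5}` for `s ≤ n^c`, `n ≥ 2`. [folklore] -/
theorem binSize_le' {n c s : ℕ} (hn : 2 ≤ n) (hs : s ≤ n ^ c) :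
    (s + 1) * (s + n.choose 2 + 1) ≤ n ^ (2 * c + 5) := by
  -- adapted from Cruxes/ConstantBand/Lines/sharpness-sandwich.lean (`binSize_le`)
  have hn1 : 1 ≤ n := by omega
  have hN : n.choose 2 ≤ n ^ 2 := Nat.choose_le_pow n 2
  have hc0 : 1 ≤ n ^ c := Nat.one_le_pow _ _ hn1
  have h1 : s + 1 ≤ n ^ (c + 1) := by
    calc s + 1 ≤ n ^ c + n ^ c := by omega
      _ = 2 * n ^ c := by ring
      _ ≤ n * n ^ c := Nat.mul_le_mul_right _ hn
      _ = n ^ (c + 1) := by ring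
  have hc2 : n ^ c ≤ n ^ (c + 2) := Nat.pow_le_pow_right hn1 (by omega)
  have h22 : n ^ 2 ≤ n ^ (c + 2) := Nat.pow_le_pow_right hn1 (by omega)
  have h02 : 1 ≤ n ^ (c + 2) := Nat.one_le_pow _ _ hn1
  have h4 : 4 ≤ n ^ 2 := by
    have := Nat.pow_le_pow_left hn 2
    simpa using this
  have h2 : s + n.choose 2 + 1 ≤ n ^ (c + 4) := by
    calc s + n.choose 2 + 1 ≤ n ^ (c + 2) + n ^ (c + 2) + n ^ (c + 2) + n ^ (c + 2) := by omega
      _ = 4 * n ^ (c + 2) := by ring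
      _ ≤ n ^ 2 * n ^ (c + 2) := Nat.mul_le_mul_right _ h4
      _ = n ^ (c + 4) := by ring
  calc (s + 1) * (s + n.choose 2 + 1) ≤ n ^ (c + 1) * n ^ (c + 4) := Nat.mul_le_mul h1 h2
    _ = n ^ (2 * c + 5) := by ring

/-- Window arithmetic from `2 ≤ j^{θ/2}` (`θ ≤ 1`, `j ≥ 1`): `j^{1-θ} + 1 ≤ j` and `j^{1-θ} + 1 ≤ j^{1-θ/2}`.
[folklore] -/
theorem window_arith' {j : ℕ} {θ : ℝ} (hθ1 : θ ≤ 1) (hj1 : (1 : ℝ) ≤ j)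
    (h2 : 2 ≤ (j : ℝ) ^ (θ / 2)) :
    (j : ℝ) ^ (1 - θ) + 1 ≤ j ∧ (j : ℝ) ^ (1 - θ) + 1 ≤ (j : ℝ) ^ (1 - θ / 2) := by
  -- adapted from Cruxes/ConstantBand/Lines/sharpness-sandwich.lean (`window_arith`)
  have hjpos : (0 : ℝ) < j := by linarith
  set a : ℝ := (j : ℝ) ^ (1 - θ) with ha
  have ha1 : 1 ≤ a := Real.one_le_rpow hj1 (by linarith)
  have ha0 : 0 ≤ a := by linarith
  have hθj : 4 ≤ (j : ℝ) ^ θ := by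
    have : (j : ℝ) ^ θ = (j : ℝ) ^ (θ / 2) * (j : ℝ) ^ (θ / 2) := by
      rw [← Real.rpow_add hjpos]; ring_nf
    rw [this]; nlinarith
  have hprod1 : a * (j : ℝ) ^ θ = j := by
    rw [ha, ← Real.rpow_add hjpos]; simp
  have hprod2 : a * (j : ℝ) ^ (θ / 2) = (j : ℝ) ^ (1 - θ / 2) := by
    rw [ha, ← Real.rpow_add hjpos]; ring_nf
  constructor
  · calc a + 1 ≤ a * 4 := by linarith
      _ ≤ a * (j : ℝ) ^ θ := mul_le_mul_of_nonneg_left hθj ha0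
      _ = j := hprod1
  · calc a + 1 ≤ a * 2 := by linarith
      _ ≤ a * (j : ℝ) ^ (θ / 2) := mul_le_mul_of_nonneg_left h2 ha0
      _ = (j : ℝ) ^ (1 - θ / 2) := hprod2

/-- **Window**: eventually in `n`, every central `j` satisfies `j₀ ≤ j`, `n ≤ 5j` and `8j ≤ C(n,2)`. [folklore] -/
theorem window_eventually' {k : ℕ} (hk : 3 ≤ k) (j₀ : ℕ) :
    ∀ᶠ n : ℕ in atTop, ∀ j : ℕ, Central k n j → j₀ ≤ j ∧ n ≤ 5 * j ∧ 8 * j ≤ n.choose 2 := by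
  -- adapted from Cruxes/ConstantBand/Lines/sharpness-sandwich.lean (`window_eventually`), with `1/16` for `8j ≤ N`
  have hk1 : (2 : ℝ) ≤ (k : ℝ) - 1 := by
    have : (3 : ℝ) ≤ k := by exact_mod_cast hk
    linarith
  have hαpos : 0 < (2 : ℝ) / ((k : ℝ) - 1) := div_pos two_pos (by linarith)
  have hα1 : (2 : ℝ) / ((k : ℝ) - 1) ≤ 1 := by rw [div_le_one (by linarith)]; exact hk1
  have hr : Tendsto (fun n : ℕ => (n : ℝ) ^ (-(2 : ℝ) / ((k : ℝ) - 1))) atTop (𝓝 0) :=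
    tendsto_rpow_threshold (k := k) (by omega)
  filter_upwards [hr.eventually (gt_mem_nhds (by norm_num : (0 : ℝ) < 1 / 16)),
    eventually_ge_atTop (max 35 (4 * j₀ + 3))] with n hn8 hn j hj
  have hn35 : 35 ≤ n := (le_max_left _ _).trans hn
  have hnj₀ : 4 * j₀ + 3 ≤ n := (le_max_right _ _).trans hn
  have hnR : (35 : ℝ) ≤ n := by exact_mod_cast hn35
  have hnpos : (0 : ℝ) < n := by linarith
  have hr0 : 0 ≤ (n : ℝ) ^ (-(2 : ℝ) / ((k : ℝ) - 1)) := Real.rpow_nonneg hnpos.le _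
  have hN : ((n.choose 2 : ℕ) : ℝ) = n * (n - 1) / 2 := Nat.cast_choose_two (K := ℝ) n
  have hNr0 : 0 ≤ ((n.choose 2 : ℕ) : ℝ) * (n : ℝ) ^ (-(2 : ℝ) / ((k : ℝ) - 1)) :=
    mul_nonneg (Nat.cast_nonneg _) hr0
  have hm_le : (thr k n : ℝ) ≤ ((n.choose 2 : ℕ) : ℝ) * (n : ℝ) ^ (-(2 : ℝ) / ((k : ℝ) - 1)) :=
    Nat.floor_le hNr0
  have hm_ge : ((n.choose 2 : ℕ) : ℝ) * (n : ℝ) ^ (-(2 : ℝ) / ((k : ℝ) - 1)) - 1 < (thr k n : ℝ) :=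
    Nat.sub_one_lt_floor _
  have hr_ge : (n : ℝ) ^ (-(1 : ℝ)) ≤ (n : ℝ) ^ (-(2 : ℝ) / ((k : ℝ) - 1)) := by
    refine Real.rpow_le_rpow_of_exponent_le (by linarith) ?_
    rw [neg_div, neg_le_neg_iff]; exact hα1
  have hNr_ge : ((n : ℝ) - 1) / 2 ≤ ((n.choose 2 : ℕ) : ℝ) * (n : ℝ) ^ (-(2 : ℝ) / ((k : ℝ) - 1)) := by
    calc ((n : ℝ) - 1) / 2 = ((n.choose 2 : ℕ) : ℝ) * (n : ℝ) ^ (-(1 : ℝ)) := by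
          rw [hN, Real.rpow_neg_one]; field_simp
      _ ≤ _ := mul_le_mul_of_nonneg_left hr_ge (Nat.cast_nonneg _)
  have hNr_le : ((n.choose 2 : ℕ) : ℝ) * (n : ℝ) ^ (-(2 : ℝ) / ((k : ℝ) - 1)) ≤ ((n.choose 2 : ℕ) : ℝ) / 16 := by
    have := mul_le_mul_of_nonneg_left hn8.le (Nat.cast_nonneg (n.choose 2) : (0 : ℝ) ≤ _)
    linarith
  have hm16 : (16 : ℝ) ≤ (thr k n : ℝ) := by linarith
  have h34 := rpow_three_quarters_le_half' hm16
  obtain ⟨hj1, hj2⟩ := abs_sub_le_iff.1 hj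
  have hjlo : (thr k n : ℝ) / 2 ≤ j := by linarith
  have hjhi : (j : ℝ) ≤ 3 * (thr k n : ℝ) / 2 := by linarith
  refine ⟨?_, ?_, ?_⟩
  · have h' : ((4 * j₀ + 3 : ℕ) : ℝ) ≤ n := by exact_mod_cast hnj₀
    push_cast at h'
    have : (j₀ : ℝ) ≤ j := by linarith
    exact_mod_cast this
  · have : (n : ℝ) ≤ 5 * j := by linarith
    exact_mod_cast this
  · have : (8 * j : ℝ) ≤ ((n.choose 2 : ℕ) : ℝ) := by linarith
    exact_mod_cast this

/-- Accepted points are clique graphs or errors: `#acc_j(D) ≤ #{x ∈ slice_j : CLIQUE_k x} + #err_j(D)`. [folklore] -/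
theorem card_acc_le_clique_add_err (n k j : ℕ) (D : Circuit (Edge n)) :
    #(univ.filter fun x : Edge n → Bool => wt x = j ∧ D.eval x = true) ≤
      #((slice n j).filter fun x => cliqueFn n k x = true) + #(errSet n k j D) := by
  refine (card_le_card ?_).trans (card_union_le _ _)
  intro x hx
  rw [mem_filter] at hx
  rw [mem_union, mem_filter, ts_mem_slice, ts_mem_errSet]
  have hwt : edgeCount x = j := hx.2.1
  by_cases hq : cliqueFn n k x = true
  · exact Or.inl ⟨hwt, hq⟩
  · refine Or.inr ⟨hwt, ?_⟩
    rw [hx.2.2]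
    exact fun h => hq h.symm

end ShallowSliceBound

open ShallowSliceBound

/-- **The support item `ShallowSliceBound` of route PneNP/OneSlice (stmt-PneNP-14083)**: for every depth `d` and
exponent `c` there are `k ≥ 3` and `δ > 0` such that, eventually in `n`, for every central edge count `j`, every
unbounded-fan-in MONOTONE circuit of `acDepth ≤ d` on the edges of `Kₙ` that errs against `k`-CLIQUE on at most a
`δ`-fraction of the slice `j` has more than `n^c` gates. [cite: Rossman2010, Thm 1 (p. 4); Tal2017, Theorem 3.6] -/
theorem shallowSliceBound_proof : Summit.PneNP.PneNP.Theses.OneSlice.ShallowSliceBound := by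
  intro d c
  -- parameters
  set c₂ : ℕ := 2 * c + 5 with hc₂
  set k : ℕ := 4 * c₂ + 5 with hkdef
  have hk5 : 5 ≤ k := by omega
  have hk3 : 3 ≤ k := by omega
  have h4c : 4 * c₂ < k := by omega
  obtain ⟨θ₀, hθ₀, δF, hδF, hFev⟩ := forcing_up k hk5 c₂ h4c (1 / 4) (by norm_num)
  set θ : ℝ := min θ₀ (1 / 2) with hθdef
  have hθ0 : 0 < θ := lt_min hθ₀ (by norm_num)
  have hθ1 : θ ≤ 1 := (min_le_right _ _).trans (by norm_num)
  have hθθ₀ : θ ≤ θ₀ := min_le_left _ _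
  obtain ⟨j₀, hSj₀⟩ := shallow_not_sharp d (2 * c) (θ / 2) (half_pos hθ0) (1 / 8) (by norm_num)
  -- `2 ≤ j^{θ/2}` for large `j`
  have hJev : ∀ᶠ j : ℕ in atTop, 2 ≤ (j : ℝ) ^ (θ / 2) :=
    ((tendsto_rpow_atTop (half_pos hθ0)).comp tendsto_natCast_atTop_atTop).eventually_ge_atTop 2
  obtain ⟨J, hJ⟩ := eventually_atTop.1 hJev
  refine ⟨k, hk3, min δF (1 / 8), lt_min hδF (by norm_num), ?_⟩
  filter_upwards [hFev, ts_eventually_window k hk3 0, window_eventually' hk3 (max (max J j₀) 5),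
    eventually_ge_atTop 2] with n hFn hQn hWn hn2 j hj D hD hdep herr
  -- read the hypotheses in the landed vocabulary
  change Central k n j at hj
  change D.IsOver monotoneACBasis at hD
  change (#(errSet n k j D) : ℝ) ≤ min δF (1 / 8) * #(slice n j) at herr
  obtain ⟨hjJ, hn5j, h8j⟩ := hWn j hj
  have hjJ' : J ≤ j := ((le_max_left _ _).trans (le_max_left _ _)).trans hjJ
  have hjj₀ : j₀ ≤ j := ((le_max_right _ _).trans (le_max_left _ _)).trans hjJ
  have hj5 : 5 ≤ j := (le_max_right _ _).trans hjJ
  have hj1 : (1 : ℝ) ≤ j := by exact_mod_cast (show 1 ≤ j by omega)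
  have hjpos : (0 : ℝ) < j := by linarith
  obtain ⟨hNpos, hQ⟩ := hQn
  obtain ⟨-, hQj⟩ := hQ j hj
  obtain ⟨hjN, hclique⟩ := hQj j (by omega)
  by_contra hbig
  have hsD : D.size ≤ n ^ c := not_lt.1 hbig
  -- binarise
  obtain ⟨C, hC01, hCeval, hCsize⟩ := stub_binarise (Edge n) D hD
  have hCsz : C.size ≤ n ^ c₂ := by
    rw [card_edgeSet_top_fin] at hCsize
    exact hCsize.trans (binSize_le' hn2 hsD)
  have hmono : Monotone D.eval := by
    rw [← hCeval]; exact C.monotone_eval_of_isOver_monotoneBasis01 hC01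
  -- error bounds
  have hsc0 : (0 : ℝ) ≤ (#(slice n j) : ℝ) := Nat.cast_nonneg _
  have herrC : (#(errSet n k j C) : ℝ) ≤ δF * #(slice n j) := by
    have : errSet n k j C = errSet n k j D := by unfold errSet; rw [hCeval]
    rw [this]
    exact herr.trans (mul_le_mul_of_nonneg_right (min_le_left _ _) hsc0)
  have herr8 : (#(errSet n k j D) : ℝ) ≤ 1 / 8 * #(slice n j) :=
    herr.trans (mul_le_mul_of_nonneg_right (min_le_right _ _) hsc0)
  -- the upper slice `t`
  obtain ⟨hwin1, hwin2⟩ := window_arith' hθ1 hj1 (hJ j hjJ')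
  set t : ℕ := ⌈(j : ℝ) + (j : ℝ) ^ (1 - θ)⌉₊ with htdef
  have hrp0 : 0 ≤ (j : ℝ) ^ (1 - θ) := Real.rpow_nonneg hjpos.le _
  have ht_ge : (j : ℝ) + (j : ℝ) ^ (1 - θ) ≤ t := Nat.le_ceil _
  have ht_lt : (t : ℝ) < (j : ℝ) + (j : ℝ) ^ (1 - θ) + 1 := Nat.ceil_lt_add_one (by positivity)
  have ht2j : t ≤ 2 * j := by
    have : (t : ℝ) ≤ 2 * j := by linarith
    exact_mod_cast this
  have htN : t ≤ n.choose 2 := by omega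
  have hjt : j ≤ t := by
    have : (j : ℝ) ≤ t := by linarith
    exact_mod_cast this
  have ht_hi : (t : ℝ) ≤ j + (j : ℝ) ^ (1 - θ / 2) := by linarith
  have h4t : 4 * t ≤ Fintype.card (Edge n) := by rw [card_edgeSet_top_fin]; omega
  -- Leg A: `a_t(C) ≥ 3/4`
  have hF_win : (j : ℝ) + (j : ℝ) ^ (1 - θ₀) ≤ t := by
    have : (j : ℝ) ^ (1 - θ₀) ≤ (j : ℝ) ^ (1 - θ) := Real.rpow_le_rpow_of_exponent_le hj1 (by linarith)
    linarith
  have hAt := hFn j hj C hC01 hCsz herrC t hF_win htN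
  rw [hCeval] at hAt
  -- clique scarcity + accuracy: `a_j(D) ≤ 1/3 + 1/8`
  have hposj : (0 : ℝ) < #(slice n j) := by exact_mod_cast ts_card_slice_pos hjN
  have hAj : sliceAvg D.eval j ≤ 1 / 3 + 1 / 8 := by
    have h1 : (#(univ.filter fun x : Edge n → Bool => wt x = j ∧ D.eval x = true) : ℝ) ≤
        #((slice n j).filter fun x => cliqueFn n k x = true) + #(errSet n k j D) := by
      exact_mod_cast card_acc_le_clique_add_err n k j D
    have h2 : (#((slice n j).filter fun x => cliqueFn n k x = true) : ℝ) ≤ 1 / 3 * #(slice n j) := by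
      have := ts_sliceFrac_clique_le (k := k) hjN hNpos (n := n)
      rw [div_le_iff₀ hposj] at this
      exact this.trans (mul_le_mul_of_nonneg_right hclique hsc0)
    rw [sliceAvg, ← slice_eq_filter_wt, div_le_iff₀ hposj]
    linarith
  -- Leg B: `a_t(D) ≤ a_j(D) + 1/8`
  have hsizeD : D.size ≤ j ^ (2 * c) := by
    have h1 : n ^ c ≤ (5 * j) ^ c := Nat.pow_le_pow_left hn5j c
    have h2 : (5 * j) ^ c ≤ (j * j) ^ c := Nat.pow_le_pow_left (Nat.mul_le_mul_right j hj5) c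
    have h3 : (j * j) ^ c = j ^ (2 * c) := by rw [← pow_two, ← pow_mul]
    omega
  have hBt := hSj₀ (Edge n) j t hjj₀ hjt ht_hi h4t D (hD.mono monotoneACBasis_subset_acBasis) hmono hdep hsizeD
  -- contradiction
  linarith

end Summit.PneNP.PneNP.Theorems

end
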